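import Summits.Ventures.QEC.CircuitDistance.PortBB72LeavesZb
import Summits.Ventures.QEC.CircuitDistance.PortComposition
import Summits.Ventures.QEC.CircuitDistance.Witnesses
import Summits.Ventures.QEC.CircuitDistance.Claims
import HarnessLib

/-!
# P3-PORT instance `[[72,12,6]]`: the VALUE THEOREM `d_circ = 6` for every number of cycles, CONDITIONAL on the named K2
# completeness binders (cell `qec`, experiment CDX, seat qec-cdx-type-1; director-qec R142 (a)/(β))

Composition of the kernel facts in the tree for print's depth-7 syndrome-measurement circuit of `[[72,12,6]]` (`bb72SM`):
* tables `bb72XTable`/`bb72ZTable` kernel-correct (`PortTablesBB72`), leaf entries covered and UNSAT (`PortBB72LeavesX/Za/Zb`,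
  over qec-cdx-eng-1's `FibreLeavesBB72Xall_01` / `Zall_01` kernel UNSAT facts) ⇒ by the sector theorems
  (`no_xLogical_of_leaves₀`, `no_zLogical_of_leaves₀`) and `not_hasAt_of_sectors`: no undetectable logical fault set of `≤ 5`
  faulty operations in the 5-cycle circuit — GIVEN the completeness binders `K2_BB72_X`, `K2_BB72_Z` below;
* the WINDOW LEMMA (`PortWindow`, N₀ = w) and monotonicity carry this to every `Nc`; eng-1's kernel WITNESS
  `bb72_hasLogicalFault_six` (`Witnesses.lean`: six faults, one cycle) and `claim_shape_of` (`PortComposition`) give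
  **`bb72_circuitDistance_eq_six : K2_BB72_X → K2_BB72_Z → ∀ Nc ≥ 1, circuitDistance bb72SM Nc = 6`**, i.e. eng-1's
  `BB72_circuitDistance_eq_six_claim`, and `¬ CDX_Q1`.
The binders `K2_BB72_X/Z : Prop` are the LIST-COMPLETENESS obligations («every non-trivial class-word of weight `≤ 5` of the
extended code is a translate of a listed orbit representative» — List_≤4 = ∅, List_5 = 1 + 7 orbits): established at
enumeration tier by two complete methods (idea-1 MITM, eng-1 DFS j312766, crit-1 audit 17:54Z) and to be discharged in the
kernel by the DFS certificate (idea-1 CARD-5) — until then this file's theorems are CONDITIONAL on them (R142 (β)).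
LABELLING OF RECORD (RIDER L): `bb72SM` has `(A₁,A₂,A₃) = (x³,y,y²)` per [BravyiEtAl2024] SI p.10 L83 and `(B₁,B₂,B₃) = (y³,x,x²)`
per print's positional convention; authors' software labelling = provenance (acq-14097 pending).  No `native_decide`.
-/

namespace Summit.Ventures.QEC.CircuitDistance

open Literature.InformationTheory.QuantumCodes

/-- **K2 COMPLETENESS binder, `X` sector of `[[72,12,6]]`** (obligation, not a literature fact): every `X`-nontrivial
CLASS-word of weight `≤ 5` of the extended code of `bb72SM` (classes of `bb72XTable`) is a `ℤ₆×ℤ₆`-translate of the listed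
orbit representative (`bb72XLeaves`).  Enumeration-tier evidence: idea-1 MITM = eng-1 DFS (List_≤4^X = ∅, List_5^X = 36 words
= 1 orbit); kernel discharge pending (DFS certificate). -/
def K2_BB72_X : Prop :=
  ∀ x : Finset (Finset (BB.Mono 6 6 ⊕ BB.Mono 6 6)), (∀ g ∈ x, IsXClass bb72XTable g) →
    XNontrivial bb72SM (∑ g ∈ x, indic g) → x.card ≤ 5 → ∃ e ∈ bb72XLeaves, ∃ t : BB.Mono 6 6, x = (e.word.map (trQ t)).toFinset

/-- **K2 COMPLETENESS binder, `Z` sector of `[[72,12,6]]`** (obligation): every `Z`-nontrivial class-word of weight `≤ 5` is a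
translate of one of the seven listed orbit representatives (`bb72ZLeaves`).  Enumeration-tier evidence: List_≤4^Z = ∅,
List_5^Z = 252 words = 7 orbits (idea-1 MITM = eng-1 DFS = crit-1 enum72); kernel discharge pending. -/
def K2_BB72_Z : Prop :=
  ∀ x : Finset (Finset (BB.Mono 6 6 ⊕ BB.Mono 6 6)), (∀ g ∈ x, IsZClass bb72ZTable g) →
    ZNontrivial bb72SM (∑ g ∈ x, indic g) → x.card ≤ 5 → ∃ e ∈ bb72ZLeaves, ∃ t : BB.Mono 6 6, x = (e.word.map (trQ t)).toFinset

/-- `X` sector: no undetectable fault set of `≤ 5` operations of the 5-cycle circuit has an `X`-nontrivial residual. -/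
theorem bb72_no_xLogical (hK : K2_BB72_X) :
    ¬ ∃ F : Finset (Fault 6 6), Undetectable bb72SM 5 F ∧ dataX bb72SM 5 F ∉ rowSpace bb72SM.toCode.HX ∧ faultCount F ≤ 5 :=
  no_xLogical_of_leaves₀ bb72SM bb72XTable bb72XTable_shapeCorrect bb72XTable_classCorrect 5 5 bb72XLeaves bb72XLeaves_ok hK

/-- `Z` sector: no undetectable fault set of `≤ 5` operations of the 5-cycle circuit has a `Z`-nontrivial residual. -/
theorem bb72_no_zLogical (hK : K2_BB72_Z) :
    ¬ ∃ F : Finset (Fault 6 6), Undetectable bb72SM 5 F ∧ dataZ bb72SM 5 F ∉ rowSpace bb72SM.toCode.HZ ∧ faultCount F ≤ 5 :=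
  no_zLogical_of_leaves₀ bb72SM bb72ZTable bb72ZTable_shapeCorrect bb72ZTable_classCorrect 5 5 bb72ZLeaves bb72ZLeaves_ok hK

/-- No undetectable logical fault set of `≤ 5` faulty operations in the 5-cycle circuit (`N₀ = w = 5`). -/
theorem bb72_not_hasAt_five (hX : K2_BB72_X) (hZ : K2_BB72_Z) : ¬ HasLogicalFaultOfWeightAtMostAt bb72SM 5 5 :=
  not_hasAt_of_sectors bb72SM 5 5 (bb72_no_xLogical hX) (bb72_no_zLogical hZ)

/-- **THE VALUE THEOREM** (conditional on K2): `d_circ([[72,12,6]], print's depth-7 SM circuit) = 6` for every `Nc ≥ 1`. -/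
theorem bb72_circuitDistance_eq_six (hX : K2_BB72_X) (hZ : K2_BB72_Z) : ∀ Nc : ℕ, 1 ≤ Nc → circuitDistance bb72SM Nc = 6 :=
  claim_shape_of bb72SM 6 (by norm_num) (bb72_not_hasAt_five hX hZ) bb72_hasLogicalFault_six

/-- The claim of `Claims.lean` (print's conjecture «distance-preserving», p. 7), conditional on K2. -/
theorem bb72_claim (hX : K2_BB72_X) (hZ : K2_BB72_Z) : BB72_circuitDistance_eq_six_claim :=
  bb72_circuitDistance_eq_six hX hZ

/-- The pre-registered question CDX-Q1 answered in the negative (conditional on K2): there is NO undetectable logical fault set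
of `≤ 5` faulty operations for ANY number of cycles; and one of `6` exists. -/
theorem bb72_claims (hX : K2_BB72_X) (hZ : K2_BB72_Z) :
    ¬ HasLogicalFaultOfWeightAtMost bb72SM 5 ∧ HasLogicalFaultOfWeightAtMost bb72SM 6 :=
  claims_of bb72SM 6 1 (bb72_not_hasAt_five hX hZ) bb72_hasLogicalFault_six

/-- `¬ CDX_Q1`, conditional on K2. -/
theorem bb72_not_CDX_Q1 (hX : K2_BB72_X) (hZ : K2_BB72_Z) : ¬ CDX_Q1 := (bb72_claims hX hZ).1

end Summit.Ventures.QEC.CircuitDistance
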